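import Summits.BirchSwinnertonDyer.BirchSwinnertonDyer.Theorems.KatoDescentPotSupersingularReducibleKatoMemberOfFineInputsCharForm
import Literature.NumberTheory.IwasawaTheory.ClassicalMuVanishesUnramifiedClassesProofs
import HarnessLib

/-!
# 27962, THE O6 NODE BEHIND CRUX M AND U₀-red FROM {Fine, H2X⁺, FW} ALONE — THE CHARACTER FORM OF IWASAWA's `μ = 0` IS NOW A
# TREE THEOREM AND LEAVES THE TRUST BASE (route-free helper for crux M = stmt-BirchSwinnertonDyer-19196 `ReducibleKatoMember`,
# K9 / K8-t′; seat `bsd-potss-rkm` g34)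

WHY.  After g33 the kernel trust base of crux M on all its rows was {`exists_isNewformOf`, `exists_memberHullZetaFineInputs` (Fine),
`exists_iwasawaH2Data_fineSelmerDual_embedding_count` (H2X⁺), `ferreroWashington1979_classicalMuVanishes` (FW),
`IwasawaTheory.classicalMuVanishes_finite_unramifiedClasses` (Iwasawa's `μ = 0` in character form)}.  This generation PROVED the
last one (`IwasawaTheory.ClassicalMuVanishesUnramifiedClasses.classicalMuVanishes_finite_unramifiedClasses_holds`, Literature
`IwasawaTheory/ClassicalMuVanishesUnramifiedClassesProofs.lean`: the finite-layer class-field-theoretic count of the everywhere-unramified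
classes fixed by `γ^{pⁿ}` against the kernel chain of the locally nilpotent operator `conj_γ − 1`; no `Λ`-module structure theory, no
`X_nr`), so every `hchar` display of g33's chain is discharged:

* `fineSelmerDual_moduleFinite_of_not_irreducible_of_FW` — **Coates–Sujatha's statement (A) on EVERY REDUCIBLE row of `E/ℚ` at an odd `p`
  from Ferrero–Washington ALONE** (dévissage over the abelian Borel field `ℚ(χ₁, χ₂)`, g33) — the only named input is the classical
  theorem of Ferrero–Washington 1979;
* `exists_memberHullZetaCoreInputs_of_fineInputs_of_FW` — **`Fine → H2X⁺ → FW → exists_memberHullZetaCoreInputs`** (27962 on K9 / K8-t′,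
  U₀-red's `PublishedInputKatoCorePackageU0Red[T]`), every row;
* `katoMemberShaBoundOfReducible_of_newform_of_fineInputs_of_FW` — the O6 node `O6.KatoMemberShaBoundOfReducible` (= crux M's decl on both
  routes) from {modularity, Fine, H2X⁺, FW};
* `missingUpperBoundAt_of_fineInputs_of_FW` — U₀-red's reducible upper half from the same atoms ⊕ {Cassels, GZK, entire `L`}.

HONEST FRAMING.  Theorems only; route-free; closes nothing by itself (crux M stays cite-level over the HELD print-exact inputs Fine and
H2X⁺ — Kato's Euler-system theorems — plus modularity and Ferrero–Washington); BSD is proved for no curve.  TRUST BASE of crux M after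
this file, in the kernel, on ALL rows: **{`exists_isNewformOf`, `Kato2004.exists_memberHullZetaFineInputs`,
`Kato2004.exists_iwasawaH2Data_fineSelmerDual_embedding_count`, `IwasawaTheory.ferreroWashington1979_classicalMuVanishes`}**.

References: [Kato2004Asterisque] Thm. 12.5 (pp. 221–222), Cor. 14.3, Thm. 14.5 (pp. 235–236), (14.9.1)–(14.9.3) (pp. 239–240), §14.14
(p. 243), Prop. 14.16 (2) (pp. 244–245); [Wuthrich2014] Lemma 14 (p. 396); [CoatesSujatha2005] Thm. 3.4, Cor. 3.6; [Lang1990] Ch. 5 §§1–4;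
[Washington1997] §13.3; [FerreroWashington1979]; tree: `…ReducibleKatoMemberOfFineInputsCharForm.lean` (g33),
`Literature/NumberTheory/IwasawaTheory/ClassicalMuVanishesUnramifiedClassesProofs.lean` (g34).
-/

-- the summit and its single problem are both named `BirchSwinnertonDyer` (registry layout D-0017)
set_option linter.dupNamespace false
set_option autoImplicit false

noncomputable section

open scoped Classical NumberField
open Field NumberField IsDedekindDomain WeierstrassCurve
open Literature.NumberTheory.EllipticCurves Literature.NumberTheory.EllipticCurves.GreenbergSelmer
open Literature.NumberTheory.EllipticCurves.ModularForms
open Literature.NumberTheory.EllipticCurves.Kato2004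
open Literature.NumberTheory.EllipticCurves.Rank1Residual Literature.NumberTheory.EllipticCurves.Rank1Residual.Typed
open Literature.NumberTheory.IwasawaTheory Literature.NumberTheory.IwasawaTheory.ClassicalMuVanishesUnramifiedClasses
open Summit.BirchSwinnertonDyer.Rank1Residual Summit.BirchSwinnertonDyer.Rank1Residual.Additive
open Summit.BirchSwinnertonDyer.BirchSwinnertonDyer.Theorems

namespace Summit.BirchSwinnertonDyer.BirchSwinnertonDyer.Theorems.FineInputsFW

/-! ## §1 Statement (A) on the reducible rows from Ferrero–Washington alone -/

/-- **Coates–Sujatha's statement (A) at `(E, p)` on every REDUCIBLE row of `E/ℚ`, `p` odd, `κ` cyclotomic, from Ferrero–Washington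
alone**: the dual fine Selmer group over `ℚ_∞` is finitely generated over `ℤ_p`.  g33's dévissage over the Borel field
(`ReducibleFineSelmerMuZeroCharForm.fineSelmerDual_moduleFinite_of_not_irreducible_of_charForm`) with the character form of `μ = 0`
now PROVED (`classicalMuVanishes_finite_unramifiedClasses_holds`). [cite: CoatesSujatha2005, Thm. 3.4 and Cor. 3.6]
[cite: FerreroWashington1979, Theorem (μ = 0 for abelian fields)] [cite: Lang1990, Ch. 5 §4 (pp. 137–143)] -/
theorem fineSelmerDual_moduleFinite_of_not_irreducible_of_FW (hFW : ferreroWashington1979_classicalMuVanishes)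
    (W : WeierstrassCurve ℚ) [W.IsElliptic] (p : ℕ) [Fact p.Prime] (hp : p ≠ 2) (hirr : ¬ W.HasIrreducibleModPGaloisRep p)
    (κ : ZpExtension ℚ p) (hκ : κ.IsCyclotomic) :
    ∃ (γ : absoluteGaloisGroup ℚ) (D : W.FineSelmerDualData κ γ),
      Module.Finite ℤ_[p] (RestrictScalars ℤ_[p] (IwasawaAlgebra p) D.X) :=
  ReducibleFineSelmerMuZeroCharForm.fineSelmerDual_moduleFinite_of_not_irreducible_of_charForm
    classicalMuVanishes_finite_unramifiedClasses_holds hFW W p hp hirr κ hκ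

/-! ## §2 27962, the O6 node and U₀-red's upper half from {Fine, H2X⁺, FW} -/

/-- **`exists_memberHullZetaFineInputs → H2X⁺ → FW → exists_memberHullZetaCoreInputs`** — the held core package 27962 on every row,
with the char-form `μ = 0` DISCHARGED. [cite: Kato2004Asterisque, Thm. 12.5 (1)–(3) (pp. 221–222), Cor. 14.3 and Thm. 14.5 (pp. 235–236), (14.9.1) (p. 239), (14.9.3) (p. 240), §14.14 (p. 243), Prop. 14.16 (2) (pp. 244–245)]
[cite: Wuthrich2014, Lemma 14 (p. 396)] [cite: CoatesSujatha2005, Cor. 3.6] -/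
theorem exists_memberHullZetaCoreInputs_of_fineInputs_of_FW (hF : exists_memberHullZetaFineInputs)
    (hH : exists_iwasawaH2Data_fineSelmerDual_embedding_count)
    (hFW : ferreroWashington1979_classicalMuVanishes) :
    exists_memberHullZetaCoreInputs :=
  FineInputsCharForm.exists_memberHullZetaCoreInputs_of_fineInputs_of_charForm hF hH
    classicalMuVanishes_finite_unramifiedClasses_holds hFW

/-- **THE O6 NODE BEHIND CRUX M (`O6.KatoMemberShaBoundOfReducible` = `ReducibleKatoMember` on K9 and K8-t′) from modularity, Fine,
H2X⁺ and FW — NO Lim, NO Imai, NO character-form named fact, ALL rows.** [cite: Kato2004Asterisque, Thm. 12.6 (p. 222), Prop. 14.16 (2) (pp. 244–245)]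
[cite: Wuthrich2014, Lemma 14 (p. 396)] -/
theorem katoMemberShaBoundOfReducible_of_newform_of_fineInputs_of_FW (hmod : exists_isNewformOf)
    (hF : exists_memberHullZetaFineInputs) (hH : exists_iwasawaH2Data_fineSelmerDual_embedding_count)
    (hFW : ferreroWashington1979_classicalMuVanishes) :
    Rank1Residual.O6.KatoMemberShaBoundOfReducible :=
  FineInputsCharForm.katoMemberShaBoundOfReducible_of_newform_of_fineInputs_of_charForm hmod hF hH
    classicalMuVanishes_finite_unramifiedClasses_holds hFW

/-- **U₀-red's reducible upper half (`MissingUpperBoundAt` at `r_an = 0`) from the same atoms — char-form DISCHARGED** (U₀-red's other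
held inputs as in the prequel). [cite: Kato2004Asterisque, §14.14 (p. 243), proof of Prop. 14.16 (pp. 244–245)] -/
theorem missingUpperBoundAt_of_fineInputs_of_FW (hne : Kato2004.nonempty_iwasawaH1Data) (hmod : exists_isNewformOf)
    (hF : exists_memberHullZetaFineInputs) (hH : exists_iwasawaH2Data_fineSelmerDual_embedding_count)
    (hFW : ferreroWashington1979_classicalMuVanishes)
    (hCassels : bsdRHS_eq_of_isIsogenous) (hGZK : rank_eq_analyticRank_of_analyticRank_le_one)
    (hmodL : hasEntireLFunction_rat)
    (W : WeierstrassCurve ℚ) [W.IsElliptic] [W.IsGloballyMinimal] (p : ℕ) [Fact p.Prime]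
    (hp : p ≠ 2) (hng : ¬ W.HasGoodReductionAtPrime p) (hnm : ¬ W.HasMultiplicativeReductionAtPrime p)
    (hj : 0 ≤ padicValRat p W.j) (hred : ¬ W.HasIrreducibleModPGaloisRep p)
    (hr : W.analyticRank = 0) : MissingUpperBoundAt W p :=
  FineInputsCharForm.missingUpperBoundAt_of_fineInputs_of_charForm hne hmod hF hH
    classicalMuVanishes_finite_unramifiedClasses_holds hFW hCassels hGZK hmodL W p hp hng hnm hj hred hr

end Summit.BirchSwinnertonDyer.BirchSwinnertonDyer.Theorems.FineInputsFW

end
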